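import Summits.BirchSwinnertonDyer.BirchSwinnertonDyer.Theorems.PlecticLegsArtinBaseChangeCoefficients

/-!
# `ArtinBaseChange` (route `PlecticLegs`, stmt-BirchSwinnertonDyer-18261): the no-continuation
# branch of `r_an(E_F)`, `F = ℚ(ζ_m)^H`, disposed of unconditionally

The tree's analytic rank `X.analyticRank = analyticOrderNatAt X.entireLFunction 1` of a Weierstrass
curve `X` over a number field is built on the classically chosen entire continuation
`X.entireLFunction` of Mathlib's `L`-series `X.LSeries`, whose documented junk value, when no entire
continuation exists (`¬ X.HasEntireLFunction`), is the series `X.LSeries` itself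
(`Literature.NumberTheory.EllipticCurves.AnalyticRank`). Over `ℚ` the junk branch is known to give
`analyticRank = 0` (`WeierstrassCurve.analyticRank_eq_zero_of_not_hasEntireLFunction`,
`Literature.NumberTheory.EllipticCurves.BSDRootNumberNoContinuationProofs`: the series diverges
absolutely on `re s ≤ 1`). This file proves the same for the base change `E_F` of an elliptic
`E / ℚ` to an abelian field `F = ℚ(ζ_m)^H` — the `F`-side of the support item `ArtinBaseChange` —
from the coefficient bounds of `PlecticLegsArtinBaseChangeCoefficients`:

* `∑_{p ≡ 1 (m)} (log p)/p = ∞` (Dirichlet, Mathlib's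
  `ArithmeticFunction.vonMangoldt.not_summable_residueClass_prime_div`) and `log p ≤ p^{1-σ}`
  eventually for `σ < 1`, so by `rpow_neg_le_norm_apply_prime_add` the Dirichlet series of `E_F`
  does NOT converge absolutely at any `s` with `re s < 1`
  (`not_LSeriesSummable_LFunction_baseChange_fixedField`); Mathlib's value of the series there is
  `0`, and by the identity theorem `analyticOrderNatAt (E_F).LSeries 1 = 0`;
* consequences: `¬ (E_F).HasEntireLFunction → (E_F).analyticRank = 0`
  (`analyticRank_baseChange_fixedField_eq_zero_of_not_hasEntireLFunction`), and contrapositively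
  `(E_F).analyticRank ≠ 0` certifies the continuation of `L(E_F, s)` — no modularity input;
* for the item: `ArtinBaseChange` holds at `(W, m, H)` as soon as `L(E, s)` and `L(E_F, s)` are
  entire TOGETHER or junk TOGETHER (`analyticRank_baseChange_fixedField_eq_of_iff`), so the item
  follows from the bare equivalence `∀ W m H, E.HasEntireLFunction ↔ (E_F).HasEntireLFunction`
  (`artinBaseChange_of_forall_hasEntireLFunction_iff`), a weakening of the named fact
  `Literature.NumberTheory.EllipticCurves.hasEntireLFunction_baseChange_fixedField` used by
  `artinBaseChange_of_hasEntireLFunction_baseChange_fixedField`; and it holds outright whenever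
  both analytic ranks are positive
  (`analyticRank_baseChange_fixedField_eq_of_analyticRank_ne_zero_of_ne_zero`). What remains of
  the item are exactly the two MIXED cases (`L(E, s)` entire and `L(E_F, s)` not, or conversely),
  vacuous in truth (BCDT modularity + abelian base change) but not decidable inside the tree: the
  proved identity `L(E_F, s) P(s) = L(E, s) Q(s) ∏_{χ ≠ 1} L(E, χ, s)` continues either side only
  meromorphically (poles at the zeros of the Dirichlet polynomials `P`, `Q`, on `re s ∈ {0, 1/2}`).
-/

noncomputable section

-- D-0017: single-problem summit, so `Summit.BirchSwinnertonDyer.BirchSwinnertonDyer.…` repeats a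
-- namespace BY DESIGN.
set_option linter.dupNamespace false

open scoped Classical
open Complex Filter Topology NumberField ArithmeticFunction IsDedekindDomain WeierstrassCurve
  Polynomial IsCyclotomicExtension.Rat

namespace Summit.BirchSwinnertonDyer.BirchSwinnertonDyer.Theorems

/-! ## The absolute divergence on `re s < 1` and the junk branch of `r_an(E_F)` -/

section Divergence

variable (W : WeierstrassCurve ℚ) [W.IsElliptic] (m : ℕ) [NeZero m] (K : Type) [Field K]
  [NumberField K] [IsCyclotomicExtension {m} ℚ K] [IsGalois ℚ K] [IsMulCommutative Gal(K/ℚ)]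
  (H : Subgroup Gal(K/ℚ))

include m in
/-- **The Dirichlet series of `E_F`, `F = ℚ(ζ_m)^H`, does not converge absolutely on `re s < 1`.**
For `E / ℚ` elliptic and `σ = re s < 1`: by `rpow_neg_le_norm_apply_prime_add` the terms at
`n = p, p²` over the primes `p ≡ 1 (mod m)` of good reduction dominate `∑_{p ≡ 1 (m)} p^{-σ}`, hence
(as `log p ≤ p^{1-σ}` eventually) `∑_{p ≡ 1 (m)} (log p)/p`, which diverges — Dirichlet's theorem
in Mathlib's form `ArithmeticFunction.vonMangoldt.not_summable_residueClass_prime_div`. (The truth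
is divergence up to `re s = 3/2`; only what the junk-value analysis needs is proved.) [folklore] -/
theorem not_LSeriesSummable_LFunction_baseChange_fixedField {s : ℂ} (hs : s.re < 1) :
    ¬ LSeriesSummable
      (⇑(((W.baseChange ↥(IntermediateField.fixedField H)).LFunction : ArithmeticFunction ℤ) :
        ArithmeticFunction ℂ)) s := by
  intro hsum
  set A : ℕ → ℂ :=
    ⇑(((W.baseChange ↥(IntermediateField.fixedField H)).LFunction : ArithmeticFunction ℤ) :
      ArithmeticFunction ℂ) with hA
  set σ : ℝ := s.re with hσ
  have hg : Summable fun n ↦ ‖LSeries.term A s n‖ := summable_norm_iff.mpr hsum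
  have hg' : ∀ n : ℕ, n ≠ 0 → ‖LSeries.term A s n‖ = ‖A n‖ / (n : ℝ) ^ σ := fun n hn ↦ by
    rw [LSeries.norm_term_eq, if_neg hn]
  have hg2 : Summable fun n : ℕ ↦ ‖LSeries.term A s (n ^ 2)‖ :=
    hg.comp_injective (Nat.pow_left_injective two_ne_zero)
  have h12 := hg.add hg2
  -- eventually `log n ≤ n^{1-σ}` and `n ∤ N_E`
  have hlog : ∀ᶠ n : ℕ in atTop, Real.log n ≤ (n : ℝ) ^ (1 - σ) := by
    have h := (isLittleO_log_rpow_atTop (by linarith : 0 < 1 - σ)).eventuallyLE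
    refine (tendsto_natCast_atTop_atTop.eventually h).mono fun n hn ↦ ?_
    rw [Real.norm_eq_abs, Real.norm_eq_abs] at hn
    exact (le_abs_self _).trans (hn.trans (abs_of_nonneg (Real.rpow_nonneg n.cast_nonneg _)).le)
  have hN : ∀ᶠ n : ℕ in atTop, ¬ n ∣ W.conductorNorm ℤ := by
    filter_upwards [eventually_gt_atTop (W.conductorNorm ℤ)] with n hn hdvd
    exact absurd (Nat.le_of_dvd W.conductorNorm_pos_holds hdvd) (not_le.mpr hn)
  -- comparison with `∑_{p ≡ 1 (m)} (log p)/p`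
  refine ArithmeticFunction.vonMangoldt.not_summable_residueClass_prime_div
    (isUnit_one : IsUnit (1 : ZMod m)) (Summable.of_norm_bounded_eventually h12 ?_)
  rw [Nat.cofinite_eq_atTop]
  filter_upwards [hlog, hN] with n hlogn hNn
  by_cases hpr : n.Prime ∧ (n : ZMod m) = 1
  · obtain ⟨hp, hpm⟩ := hpr
    have hn0 : (0 : ℝ) < n := by exact_mod_cast hp.pos
    have hres : ArithmeticFunction.vonMangoldt.residueClass (1 : ZMod m) n = Real.log n := by
      rw [ArithmeticFunction.vonMangoldt.residueClass, Set.indicator_of_mem (by exact hpm),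
        ArithmeticFunction.vonMangoldt_apply_prime hp]
    rw [if_pos hp, hres, Real.norm_of_nonneg (div_nonneg (Real.log_natCast_nonneg n) n.cast_nonneg),
      hg' n hp.ne_zero, hg' (n ^ 2) (pow_ne_zero 2 hp.ne_zero)]
    calc Real.log n / n ≤ (n : ℝ) ^ (1 - σ) / n := by gcongr
      _ = (n : ℝ) ^ (-σ) := by
          rw [← Real.rpow_sub_one hn0.ne']
          ring_nf
      _ ≤ _ := rpow_neg_le_norm_apply_prime_add W m K H hp hpm hNn hs.le
  · have h0 : (if n.Prime then ArithmeticFunction.vonMangoldt.residueClass (1 : ZMod m) n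
        else 0) / (n : ℝ) = 0 := by
      split_ifs with hp
      · have hpm : (n : ZMod m) ≠ 1 := fun h ↦ hpr ⟨hp, h⟩
        rw [ArithmeticFunction.vonMangoldt.residueClass, Set.indicator_of_notMem (by exact hpm),
          zero_div]
      · rw [zero_div]
    rw [h0, norm_zero]
    positivity

include m in
/-- On the open half-plane `re s < 1`, Mathlib's `L`-series of `E_F` takes the value `0` — the
conventional value of a non-summable series (`LSeries.eq_zero_of_not_LSeriesSummable`). A
statement about Mathlib's junk convention, not about `L(E_F, s)`. [folklore] -/
theorem LSeries_baseChange_fixedField_eq_zero_of_re_lt_one {s : ℂ} (hs : s.re < 1) :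
    (W.baseChange ↥(IntermediateField.fixedField H)).LSeries s = 0 :=
  LSeries.eq_zero_of_not_LSeriesSummable _ _
    (not_LSeriesSummable_LFunction_baseChange_fixedField W m K H hs)

include m in
/-- For `E / ℚ` elliptic and `F = ℚ(ζ_m)^H`, the order of vanishing at `s = 1` of the SERIES
`(E_F).LSeries` (Mathlib's conventions) is `0`: the series vanishes on the open set `re s < 1`, so
if it is analytic at `1` it vanishes identically near `1` by the identity theorem (order `⊤`, read
as `0` in `ℕ`); otherwise the order is `0` by convention. [folklore] -/
theorem analyticOrderNatAt_LSeries_baseChange_fixedField_one :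
    analyticOrderNatAt (W.baseChange ↥(IntermediateField.fixedField H)).LSeries 1 = 0 := by
  set X := W.baseChange ↥(IntermediateField.fixedField H) with hX
  by_cases han : AnalyticAt ℂ X.LSeries 1
  · have hzero : ∀ᶠ z in 𝓝 (1 : ℂ), X.LSeries z = 0 := by
      obtain ⟨r, hr, hball⟩ := han.exists_ball_analyticOnNhd
      have hz₀ : ((1 - r / 2 : ℝ) : ℂ) ∈ Metric.ball (1 : ℂ) r := by
        rw [Metric.mem_ball, Complex.dist_eq,
          show ((1 - r / 2 : ℝ) : ℂ) - 1 = ((-(r / 2) : ℝ) : ℂ) by push_cast; ring,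
          Complex.norm_real, Real.norm_eq_abs, abs_neg, abs_of_pos (by positivity)]
        linarith
      have hev : X.LSeries =ᶠ[𝓝 ((1 - r / 2 : ℝ) : ℂ)] 0 := by
        have hopen : IsOpen {s : ℂ | s.re < 1} := isOpen_lt Complex.continuous_re continuous_const
        filter_upwards [hopen.mem_nhds (show ((1 - r / 2 : ℝ) : ℂ).re < 1 by
          rw [Complex.ofReal_re]; linarith)] with s hs
        exact LSeries_baseChange_fixedField_eq_zero_of_re_lt_one W m K H hs
      have heq := hball.eqOn_zero_of_preconnected_of_eventuallyEq_zero
        (convex_ball (1 : ℂ) r).isPreconnected hz₀ hev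
      filter_upwards [Metric.ball_mem_nhds (1 : ℂ) hr] with z hz
      exact heq hz
    have htop : analyticOrderAt X.LSeries 1 = ⊤ := analyticOrderAt_eq_top.mpr hzero
    simp [analyticOrderNatAt, htop]
  · exact analyticOrderNatAt_of_not_analyticAt han

include m in
/-- **No continuation ⇒ analytic rank `0`, over `F = ℚ(ζ_m)^H`.** If `L(E_F, s)` has no entire
continuation, the tree's `(E_F).entireLFunction` is the series `(E_F).LSeries` itself (documented
junk value of `Literature.NumberTheory.EllipticCurves.AnalyticRank`), whose order at `1` is `0`
(`analyticOrderNatAt_LSeries_baseChange_fixedField_one`); so `(E_F).analyticRank = 0`.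
[folklore] -/
theorem analyticRank_baseChange_fixedField_eq_zero_of_not_hasEntireLFunction
    (h : ¬ (W.baseChange ↥(IntermediateField.fixedField H)).HasEntireLFunction) :
    (W.baseChange ↥(IntermediateField.fixedField H)).analyticRank = 0 := by
  set X := W.baseChange ↥(IntermediateField.fixedField H) with hX
  have h' : ¬ (entireContinuations X).Nonempty := h
  have hL : X.entireLFunction = X.LSeries := by
    unfold entireLFunction
    rw [dif_neg h']
  unfold analyticRank
  rw [hL]
  exact analyticOrderNatAt_LSeries_baseChange_fixedField_one W m K H

include m in
/-- **Positive analytic rank of `E_F` certifies the continuation of `L(E_F, s)`**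
(`F = ℚ(ζ_m)^H`), unconditionally: in the junk branch the rank is `0`. [folklore] -/
theorem hasEntireLFunction_baseChange_fixedField_of_analyticRank_ne_zero
    (h : (W.baseChange ↥(IntermediateField.fixedField H)).analyticRank ≠ 0) :
    (W.baseChange ↥(IntermediateField.fixedField H)).HasEntireLFunction := by
  by_contra hE
  exact h (analyticRank_baseChange_fixedField_eq_zero_of_not_hasEntireLFunction W m K H hE)

end Divergence

/-! ## Consequences for the item `ArtinBaseChange` -/

section Item

set_option backward.isDefEq.respectTransparency false in
/-- **`ArtinBaseChange` at `(W, m, H)` from the co-occurrence of the two continuations.** For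
`E / ℚ` elliptic, `m ≥ 1`, `H ≤ Gal(ℚ(ζ_m)/ℚ)`, `F = ℚ(ζ_m)^H`: under the twisted non-vanishing
hypothesis of the item, if `L(E, s)` has an entire continuation iff `L(E_F, s)` does, then
`r_an(E_F) = r_an(E)`. Both entire: the proved Artin formalism
(`analyticRank_baseChange_fixedField_eq`); neither: both ranks are the junk value `0`
(`WeierstrassCurve.analyticRank_eq_zero_of_not_hasEntireLFunction` over `ℚ`,
`analyticRank_baseChange_fixedField_eq_zero_of_not_hasEntireLFunction` over `F`). [folklore] -/
theorem analyticRank_baseChange_fixedField_eq_of_iff (W : WeierstrassCurve ℚ) [W.IsElliptic]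
    (m : ℕ) [NeZero m] (H : Subgroup (CyclotomicField m ℚ ≃ₐ[ℚ] CyclotomicField m ℚ))
    (hχ : ∀ χ : DirichletCharacter ℂ m,
      (∀ σ ∈ H, ∀ a : ℕ, (∀ z : CyclotomicField m ℚ, z ^ m = 1 → σ z = z ^ a) →
        χ (a : ZMod m) = 1) → χ ≠ 1 →
      ∃ L : ℂ → ℂ, Differentiable ℂ L ∧
        (∀ s : ℂ, 2 < s.re → L s = LSeries (fun n ↦ χ n * ((W.LFunction n : ℤ) : ℂ)) s) ∧ L 1 ≠ 0)
    (hiff : W.HasEntireLFunction ↔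
      (W.baseChange ↥(IntermediateField.fixedField H)).HasEntireLFunction) :
    (W.baseChange ↥(IntermediateField.fixedField H)).analyticRank = W.analyticRank := by
  by_cases hW : W.HasEntireLFunction
  · exact analyticRank_baseChange_fixedField_eq W m H hχ (hiff.mp hW) hW
  · haveI : IsCyclotomicExtension {m} ℚ (CyclotomicField m ℚ) :=
      CyclotomicField.isCyclotomicExtension m ℚ
    haveI : IsAbelianGalois ℚ (CyclotomicField m ℚ) :=
      IsCyclotomicExtension.isAbelianGalois {m} ℚ (CyclotomicField m ℚ)
    rw [W.analyticRank_eq_zero_of_not_hasEntireLFunction hW,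
      analyticRank_baseChange_fixedField_eq_zero_of_not_hasEntireLFunction W m
        (CyclotomicField m ℚ) H (fun h ↦ hW (hiff.mpr h))]

/-- **`ArtinBaseChange` modulo the bare co-occurrence of continuations.** The support item follows
from `∀ E m H, L(E_F, s) entire ↔ L(E, s) entire` (`F = ℚ(ζ_m)^H`) — a consequence of, and
weaker than, the named fact
`Literature.NumberTheory.EllipticCurves.hasEntireLFunction_baseChange_fixedField` (which gives
both sides outright, the right one at `m = 1`, `hasEntireLFunction_rat_of`). What the item still
needs from outside the tree is thus only the exclusion of the two mixed cases. [folklore] -/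
theorem artinBaseChange_of_forall_hasEntireLFunction_iff
    (h : ∀ (W : WeierstrassCurve ℚ) [W.IsElliptic] (m : ℕ) [NeZero m]
      (H : Subgroup (CyclotomicField m ℚ ≃ₐ[ℚ] CyclotomicField m ℚ)),
      W.HasEntireLFunction ↔ (W.baseChange ↥(IntermediateField.fixedField H)).HasEntireLFunction) :
    Summit.BirchSwinnertonDyer.BirchSwinnertonDyer.Theses.PlecticLegs.ArtinBaseChange := by
  intro W _ m _ H hχ
  exact analyticRank_baseChange_fixedField_eq_of_iff W m H hχ (h W m H)

/-- The named fact `hasEntireLFunction_baseChange_fixedField` gives the co-occurrence hypothesis of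
`artinBaseChange_of_forall_hasEntireLFunction_iff` (both sides hold; the `E`-side at `m = 1`,
`hasEntireLFunction_rat_of`), so that theorem composed with this one is the landed
`artinBaseChange_of_hasEntireLFunction_baseChange_fixedField`. [folklore] -/
theorem forall_hasEntireLFunction_iff_of
    (hX : Literature.NumberTheory.EllipticCurves.hasEntireLFunction_baseChange_fixedField)
    (W : WeierstrassCurve ℚ) [W.IsElliptic] (m : ℕ) [NeZero m]
    (H : Subgroup (CyclotomicField m ℚ ≃ₐ[ℚ] CyclotomicField m ℚ)) :
    W.HasEntireLFunction ↔ (W.baseChange ↥(IntermediateField.fixedField H)).HasEntireLFunction :=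
  ⟨fun _ ↦ hX W m H, fun _ ↦ hasEntireLFunction_rat_of hX W⟩

/-- **`ArtinBaseChange` at `(W, m, H)` when both analytic ranks are positive**, unconditionally:
`r_an(E) ≠ 0` and `r_an(E_F) ≠ 0` each certify the corresponding entire continuation
(`WeierstrassCurve.hasEntireLFunction_of_analyticRank_ne_zero`,
`hasEntireLFunction_baseChange_fixedField_of_analyticRank_ne_zero`), and then the proved Artin
formalism applies (`analyticRank_baseChange_fixedField_eq`). [folklore] -/
theorem analyticRank_baseChange_fixedField_eq_of_analyticRank_ne_zero_of_ne_zero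
    (W : WeierstrassCurve ℚ) [W.IsElliptic] (m : ℕ) [NeZero m]
    (H : Subgroup (CyclotomicField m ℚ ≃ₐ[ℚ] CyclotomicField m ℚ))
    (hχ : ∀ χ : DirichletCharacter ℂ m,
      (∀ σ ∈ H, ∀ a : ℕ, (∀ z : CyclotomicField m ℚ, z ^ m = 1 → σ z = z ^ a) →
        χ (a : ZMod m) = 1) → χ ≠ 1 →
      ∃ L : ℂ → ℂ, Differentiable ℂ L ∧
        (∀ s : ℂ, 2 < s.re → L s = LSeries (fun n ↦ χ n * ((W.LFunction n : ℤ) : ℂ)) s) ∧ L 1 ≠ 0)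
    (hr : W.analyticRank ≠ 0)
    (hrF : (W.baseChange ↥(IntermediateField.fixedField H)).analyticRank ≠ 0) :
    (W.baseChange ↥(IntermediateField.fixedField H)).analyticRank = W.analyticRank := by
  haveI : IsCyclotomicExtension {m} ℚ (CyclotomicField m ℚ) :=
    CyclotomicField.isCyclotomicExtension m ℚ
  haveI : IsAbelianGalois ℚ (CyclotomicField m ℚ) :=
    IsCyclotomicExtension.isAbelianGalois {m} ℚ (CyclotomicField m ℚ)
  exact analyticRank_baseChange_fixedField_eq_of_analyticRank_ne_zero W m H hχ
    (hasEntireLFunction_baseChange_fixedField_of_analyticRank_ne_zero W m (CyclotomicField m ℚ) H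
      hrF) hr

end Item

end Summit.BirchSwinnertonDyer.BirchSwinnertonDyer.Theorems

end
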